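import Summits.AtomisticToContinuum.Crystallization.Theorems.FreeSplittingCertificatesStrictSplittingRuleHcpExteriorHardy

/-!
# `StrictSplittingRule` (stmt-AtomisticToContinuum-12560): the hcp-exterior Hardy inequality, radial form

Route `FreeSplittingCertificates`, crux r3 `StrictSplittingRule`, line `registered` (unit b2b-freesplit-B, gen 6).
Companion of `…StrictSplittingRuleHcpExteriorHardy.lean`: the radial margin `κ(a,h,r)` of `…HcpHardyWeight.lean` is nondecreasing
in `r` (`hcpHardyWeight_kappa_mono`), so for a field supported on `{‖y‖ ≥ R}` the single constant `κ(a,h,R)` serves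
(`hcpExterior_hardy_radial`); and for `R` larger than both bond lengths `a`, `√(a²/3 + h²)` the root-shell hypothesis is automatic
(`hcpSite_far_ne_zero`, `hcpExterior_hardy_radial'`).  Structural bookkeeping ([folklore]); VALUE = a kernel-checked brick of the
far lemma of the H12⋆ architecture (HOME CERT.md §15) — NOT summit progress.
-/

noncomputable section

namespace Summit.AtomisticToContinuum.Crystallization.Theorems.StrictSplittingRuleBirth

open scoped BigOperators
open Literature.MathematicalPhysics.StatisticalMechanics
open Summit.AtomisticToContinuum.Crystallization.Theorems.PalmUnimodularRigidity.LayeredLawsSelectHcp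

/-! ## Radial form -/

/-- The radial margin is nondecreasing in `r`: all its correction terms are nonnegative and decay. [folklore] -/
theorem hcpHardyWeight_kappa_mono {a h R r : ℝ} (ha : 0 < a) (hh : 0 < h) (hR : 0 < R) (hRr : R ≤ r) :
    3 * min (16 * a ^ 2) (24 * h ^ 2) - 16 * a ^ 2 - 12 * h ^ 2 -
          (72 * max (3 * a ^ 4 + a ^ 2 * (a ^ 2 / 3 + h ^ 2)) (6 * (a ^ 2 / 3 + h ^ 2) * h ^ 2) - 18 * a ^ 4 -
              18 * (a ^ 2 / 3 + h ^ 2) ^ 2) / R ^ 2 -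
          8 * √3 * a ^ 3 / R - 36 * (a ^ 6 + (a ^ 2 / 3 + h ^ 2) ^ 3) / R ^ 4 ≤
      3 * min (16 * a ^ 2) (24 * h ^ 2) - 16 * a ^ 2 - 12 * h ^ 2 -
          (72 * max (3 * a ^ 4 + a ^ 2 * (a ^ 2 / 3 + h ^ 2)) (6 * (a ^ 2 / 3 + h ^ 2) * h ^ 2) - 18 * a ^ 4 -
              18 * (a ^ 2 / 3 + h ^ 2) ^ 2) / r ^ 2 -
          8 * √3 * a ^ 3 / r - 36 * (a ^ 6 + (a ^ 2 / 3 + h ^ 2) ^ 3) / r ^ 4 := by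
  have hr : 0 < r := lt_of_lt_of_le hR hRr
  -- the three coefficients are nonnegative
  have hC2 : 0 ≤ 72 * max (3 * a ^ 4 + a ^ 2 * (a ^ 2 / 3 + h ^ 2)) (6 * (a ^ 2 / 3 + h ^ 2) * h ^ 2) - 18 * a ^ 4 -
      18 * (a ^ 2 / 3 + h ^ 2) ^ 2 := by
    have h1 := le_max_left (3 * a ^ 4 + a ^ 2 * (a ^ 2 / 3 + h ^ 2)) (6 * (a ^ 2 / 3 + h ^ 2) * h ^ 2)
    have h2 := le_max_right (3 * a ^ 4 + a ^ 2 * (a ^ 2 / 3 + h ^ 2)) (6 * (a ^ 2 / 3 + h ^ 2) * h ^ 2)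
    nlinarith [sq_nonneg a, sq_nonneg h, mul_pos ha hh, pow_pos ha 4, pow_pos hh 2,
      mul_nonneg (sq_nonneg a) (sq_nonneg h)]
  have hC1 : 0 ≤ 8 * √3 * a ^ 3 := by positivity
  have hC4 : 0 ≤ 36 * (a ^ 6 + (a ^ 2 / 3 + h ^ 2) ^ 3) := by positivity
  set C2 := 72 * max (3 * a ^ 4 + a ^ 2 * (a ^ 2 / 3 + h ^ 2)) (6 * (a ^ 2 / 3 + h ^ 2) * h ^ 2) - 18 * a ^ 4 -
      18 * (a ^ 2 / 3 + h ^ 2) ^ 2 with hC2def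
  set C1 := 8 * √3 * a ^ 3 with hC1def
  set C4 := 36 * (a ^ 6 + (a ^ 2 / 3 + h ^ 2) ^ 3) with hC4def
  have i2 : C2 / r ^ 2 ≤ C2 / R ^ 2 := div_le_div_of_nonneg_left hC2 (by positivity) (pow_le_pow_left₀ hR.le hRr 2)
  have i1 : C1 / r ≤ C1 / R := div_le_div_of_nonneg_left hC1 hR hRr
  have i4 : C4 / r ^ 4 ≤ C4 / R ^ 4 := div_le_div_of_nonneg_left hC4 (by positivity) (pow_le_pow_left₀ hR.le hRr 4)
  linarith

/-- **Radial form of the hcp-exterior Hardy inequality.**  If `f` is supported on sites with `‖y_x‖ ≥ R > 0` (together with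
the support conditions of `hcpExterior_hardy`), then with `κ(R)` = the radial margin at `R`:
`κ(R) Σ_x ‖y_x‖⁻⁸ f(x)² ≤ Σ_x ‖y_x‖⁻⁶ Σ_s (f(x_s) − f(x))²`. [folklore] -/
theorem hcpExterior_hardy_radial {a h R : ℝ} (ha : 0 < a) (hh : 0 < h) (hR : 0 < R) (f : ℤ × ℤ × ℤ → ℝ)
    (V : Finset (ℤ × ℤ × ℤ))
    (hV : ∀ x, f x ≠ 0 → x ∈ V ∧ ∀ s ∈ hcpStarIdx, x + (if Even x.1 then s else -s) ∈ V)
    (hfar : ∀ x, f x ≠ 0 → x ≠ 0 ∧ ∀ s ∈ hcpStarIdx, x + (if Even x.1 then s else -s) ≠ 0)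
    (hRx : ∀ x, f x ≠ 0 → R ≤ ‖hcpSite a h x‖) :
    (3 * min (16 * a ^ 2) (24 * h ^ 2) - 16 * a ^ 2 - 12 * h ^ 2 -
          (72 * max (3 * a ^ 4 + a ^ 2 * (a ^ 2 / 3 + h ^ 2)) (6 * (a ^ 2 / 3 + h ^ 2) * h ^ 2) - 18 * a ^ 4 -
              18 * (a ^ 2 / 3 + h ^ 2) ^ 2) / R ^ 2 -
          8 * √3 * a ^ 3 / R - 36 * (a ^ 6 + (a ^ 2 / 3 + h ^ 2) ^ 3) / R ^ 4) *
        ∑ x ∈ V, ((‖hcpSite a h x‖ ^ 2) ^ 4)⁻¹ * f x ^ 2 ≤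
      ∑ x ∈ V, ((‖hcpSite a h x‖ ^ 2) ^ 3)⁻¹ *
        ∑ s ∈ hcpStarIdx, (f (x + (if Even x.1 then s else -s)) - f x) ^ 2 :=
  hcpExterior_hardy ha hh f V _ hV hfar fun x hx => hcpHardyWeight_kappa_mono ha hh hR (hRx x hx)

/-- **Far sites are not in the root's shell**: if `‖y_x‖ > a` and `‖y_x‖ > √(a²/3 + h²)` then `x ≠ 0` and every neighbour
`x_s ≠ 0` (the bond lengths are `a` and `√(a²/3 + h²)`). [folklore] -/
theorem hcpSite_far_ne_zero {a h : ℝ} (ha : 0 < a) {x : ℤ × ℤ × ℤ} (hxa : a < ‖hcpSite a h x‖)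
    (hxb : Real.sqrt (a ^ 2 / 3 + h ^ 2) < ‖hcpSite a h x‖) :
    x ≠ 0 ∧ ∀ s ∈ hcpStarIdx, x + (if Even x.1 then s else -s) ≠ 0 := by
  refine ⟨fun h0 => ?_, fun s hs h0 => ?_⟩
  · rw [h0, hcpSite_zero, norm_zero] at hxa; exact absurd hxa (not_lt.2 ha.le)
  · have e := hcpBond_norm_sq a h x s
    rw [h0, hcpSite_zero, norm_zero, zero_pow two_ne_zero] at e
    -- so ±y_x + y_s = 0, i.e. ‖y_x‖ = ‖y_s‖, contradicting the strict inequalities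
    have hz : (if Even x.1 then hcpSite a h x else -hcpSite a h x) + hcpSite a h s = 0 := by
      rwa [eq_comm, pow_eq_zero_iff two_ne_zero, norm_eq_zero] at e
    have hnorm : ‖hcpSite a h x‖ = ‖hcpSite a h s‖ := by
      have : hcpSite a h s = -(if Even x.1 then hcpSite a h x else -hcpSite a h x) := by
        rw [eq_neg_iff_add_eq_zero, add_comm]; exact hz
      rw [this, norm_neg]; split_ifs <;> simp [norm_neg]
    have hs2 := hcpShell_norm_sq a h hs
    by_cases h0s : s.1 = 0
    · rw [if_pos h0s] at hs2
      have : ‖hcpSite a h s‖ = a := by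
        have hn : 0 ≤ ‖hcpSite a h s‖ := norm_nonneg _
        nlinarith [hs2, ha]
      rw [hnorm, this] at hxa; exact lt_irrefl _ hxa
    · rw [if_neg h0s] at hs2
      have : ‖hcpSite a h s‖ = Real.sqrt (a ^ 2 / 3 + h ^ 2) := by
        rw [← hs2, Real.sqrt_sq (norm_nonneg _)]
      rw [hnorm, this] at hxb; exact lt_irrefl _ hxb

/-- **Radial form, far-support version**: for `f` supported on `{‖y‖ ≥ R}` with `R > a`, `R > √(a²/3 + h²)`, no separate root-shell
hypothesis is needed. [folklore] -/
theorem hcpExterior_hardy_radial' {a h R : ℝ} (ha : 0 < a) (hh : 0 < h) (hRa : a < R) (hRb : Real.sqrt (a ^ 2 / 3 + h ^ 2) < R)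
    (f : ℤ × ℤ × ℤ → ℝ) (V : Finset (ℤ × ℤ × ℤ))
    (hV : ∀ x, f x ≠ 0 → x ∈ V ∧ ∀ s ∈ hcpStarIdx, x + (if Even x.1 then s else -s) ∈ V)
    (hRx : ∀ x, f x ≠ 0 → R ≤ ‖hcpSite a h x‖) :
    (3 * min (16 * a ^ 2) (24 * h ^ 2) - 16 * a ^ 2 - 12 * h ^ 2 -
          (72 * max (3 * a ^ 4 + a ^ 2 * (a ^ 2 / 3 + h ^ 2)) (6 * (a ^ 2 / 3 + h ^ 2) * h ^ 2) - 18 * a ^ 4 -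
              18 * (a ^ 2 / 3 + h ^ 2) ^ 2) / R ^ 2 -
          8 * √3 * a ^ 3 / R - 36 * (a ^ 6 + (a ^ 2 / 3 + h ^ 2) ^ 3) / R ^ 4) *
        ∑ x ∈ V, ((‖hcpSite a h x‖ ^ 2) ^ 4)⁻¹ * f x ^ 2 ≤
      ∑ x ∈ V, ((‖hcpSite a h x‖ ^ 2) ^ 3)⁻¹ *
        ∑ s ∈ hcpStarIdx, (f (x + (if Even x.1 then s else -s)) - f x) ^ 2 :=
  hcpExterior_hardy_radial ha hh (ha.trans hRa) f V hV
    (fun x hx => hcpSite_far_ne_zero ha (hRa.trans_le (hRx x hx)) (hRb.trans_le (hRx x hx))) hRx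

end Summit.AtomisticToContinuum.Crystallization.Theorems.StrictSplittingRuleBirth

end
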